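import Summits.BirchSwinnertonDyer.BirchSwinnertonDyer.Theorems.ByReductionTypeAtTwoRankOneAtTwoBigImageOddLocalFklLevelShift
import Summits.BirchSwinnertonDyer.Rank1Residual.Additive.SemistableTwistAnalyticSigned
import Literature.NumberTheory.EllipticCurves.Rank1Residual.PeriodUnitProofs
import HarnessLib

/-!
# Line `fkl` of crux `RankOneAtTwoBigImageOddLocal` (stmt-BirchSwinnertonDyer-23715, route ByReductionTypeAtTwo):
# level two of K2-F in L-VALUE currency — `T_ℓ(f)` is `L(E^{(ℓ)},1)/Ω(E^{(ℓ)})` up to a `2`-adic unit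

Lead prover seat `bsd-line-fkl-p1` (g2), helpers `--supports stmt-BirchSwinnertonDyer-23715` (v7 stubs (2a)/(2b)/(3a)/(3b)); sequel to
`…FklLevelShift` (p598376: at every `τ`-prime `ℓ ≡ 1 (4)` and every `ψ` onto `ℤ/4`, `δ'_2(ℓ;ψ) ∈ 2^m ℤ_{(2)} ⟺ T_ℓ(f) ∈ 2^m ℤ_{(2)}`,
`m ≤ 2`).

**Birch reading (kernel).**  `E = W` globally minimal with newform `f` and the period transfer at `2` (`Ω(W) = u·Ω⁺_f`, `|u|₂ = 1` — the
fkl stub (1)(iii)(iv)/(4) input), `ℓ` a `τ`-prime with `ℓ ≡ 1 (mod 4)`, `W'` a globally minimal model of the quadratic twist `E^{(ℓ)}`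
(`C • W.quadraticTwist ℓ = W'`; it has additive reduction at `ℓ`).  The cell's PROVED signed Birch × Pal × Gauss identity
`Additive.entireLFunction_one_eq_of_twist_pos` (modularity `hasEntireLFunction_rat` its only named input) gives
`L(E^{(ℓ)}, 1) = u⁻¹ · (∑_a (a/ℓ)[a/ℓ]⁺_f) · Ω(E^{(ℓ)})`, and `∑_a (a/ℓ)[a/ℓ]⁺_f = T_ℓ(f)` (`legendrePlusSymbolSum_eq_twistSymbolSum`).
Hence for the rational `r = L(E^{(ℓ)},1)/Ω(E^{(ℓ)})`:  `r ∈ 2^m ℤ_{(2)} ⟺ T_ℓ(f) ∈ 2^m ℤ_{(2)}` (`inTwoPowZLoc_twistLValue_iff`), so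
* (HC) of K2-F at a level-2 row reads «`Ш(E)[2] ≠ 0 ⇒ L(E^{(ℓ)},1)/Ω(E^{(ℓ)}) ∈ 4ℤ_{(2)}`» (`firstLayerHigherCongruence_levelTwo_iff_twistLValue`);
* (NV) for parameter `0` holds as soon as ONE `τ`-prime `ℓ ≡ 1 (4)` with `4 ∣ a_ℓ − 2` has `L(E^{(ℓ)},1)/Ω(E^{(ℓ)}) ∉ 4ℤ_{(2)}`
  (`firstLayerNonVanishing_zero_of_twistLValue`, stub-binder form `stub_firstLayerNonVanishing_of_sha_trivial_of_twistLValue`) — by BSD₂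
  for the rank-0 twist this is «`Ш(E^{(ℓ)})[2] = 0`» (`c_ℓ(E^{(ℓ)}) = 2`, other local terms odd), i.e. a Kummer `τ`-prime.
Also: `2^k ℤ_{(2)}`-membership via `ord₂` (`inTwoPowZLoc_iff_padicValRat`), invariance under `2`-adic units (`inTwoPowZLoc_unit_mul_iff`).
Theorems only; no `def`, no `sorry`; the one named fact (`hasEntireLFunction_rat`, modularity) enters as an explicit hypothesis.
BSD is not proved by any of this.
-/

set_option autoImplicit false

noncomputable section

open scoped Classical MatrixGroups ModularForm

set_option linter.dupNamespace false

namespace Summit.BirchSwinnertonDyer.BirchSwinnertonDyer.Theorems.RankOneAtTwoFkl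

open CongruenceSubgroup WeierstrassCurve Literature.NumberTheory.EllipticCurves
  Literature.NumberTheory.EllipticCurves.ModularForms Literature.NumberTheory.EllipticCurves.Rank1Residual
  Summit.BirchSwinnertonDyer.Rank1Residual.F1Sign2 Summit.BirchSwinnertonDyer.Rank1Residual.Additive

/-! ## `2^k ℤ_{(2)}` through `ord₂` -/

/-- A rational has odd denominator iff its `2`-adic valuation is non-negative (`ord₂ 0 = 0`). [folklore] -/
theorem odd_den_iff_padicValRat_nonneg (q : ℚ) : Odd q.den ↔ 0 ≤ padicValRat 2 q := by
  constructor
  · intro hodd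
    have hnd : ¬ 2 ∣ q.den := fun h => (Nat.not_even_iff_odd.mpr hodd) (even_iff_two_dvd.mpr h)
    show (0 : ℤ) ≤ (padicValInt 2 q.num : ℤ) - (padicValNat 2 q.den : ℤ)
    rw [padicValNat.eq_zero_of_not_dvd hnd]
    simp
  · intro hv
    by_contra hodd
    have heven : 2 ∣ q.den := even_iff_two_dvd.mp (Nat.not_odd_iff_even.mp hodd)
    have hcop : q.num.natAbs.Coprime q.den := q.reduced
    have hnum : ¬ (2 : ℤ) ∣ q.num := by
      intro h
      have h2 : 2 ∣ q.num.natAbs := by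
        have := Int.natAbs_dvd_natAbs.mpr h
        simpa using this
      have h21 : 2 ∣ Nat.gcd q.num.natAbs q.den := Nat.dvd_gcd h2 heven
      rw [hcop.gcd_eq_one] at h21
      omega
    have h0 : padicValInt 2 q.num = 0 := padicValInt.eq_zero_of_not_dvd (by exact_mod_cast hnum)
    have h1 : 1 ≤ padicValNat 2 q.den := one_le_padicValNat_of_dvd q.den_nz heven
    have : padicValRat 2 q = (padicValInt 2 q.num : ℤ) - (padicValNat 2 q.den : ℤ) := rfl
    rw [this, h0] at hv
    omega

/-- **`x ∈ 2^k ℤ_{(2)}` iff `x = 0` or `ord₂ x ≥ k`.** [folklore] -/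
theorem inTwoPowZLoc_iff_padicValRat (k : ℕ) (x : ℚ) :
    InTwoPowZLoc k x ↔ x = 0 ∨ (x ≠ 0 ∧ (k : ℤ) ≤ padicValRat 2 x) := by
  have h2k : padicValRat 2 ((2 : ℚ) ^ k) = k := by
    rw [padicValRat.pow, show ((2 : ℚ)) = ((2 : ℕ) : ℚ) by norm_num, padicValRat.self (by norm_num)]
    ring
  have h2k0 : ((2 : ℚ) ^ k) ≠ 0 := by positivity
  constructor
  · rintro ⟨q, hq, hd⟩
    by_cases hq0 : q = 0
    · left; rw [hq, hq0, mul_zero]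
    · right
      refine ⟨by rw [hq]; exact mul_ne_zero h2k0 hq0, ?_⟩
      rw [hq, padicValRat.mul h2k0 hq0, h2k]
      have := (odd_den_iff_padicValRat_nonneg q).mp hd
      omega
  · rintro (rfl | ⟨hx0, hv⟩)
    · exact ⟨0, by simp, by simp⟩
    · refine ⟨x / 2 ^ k, by field_simp, ?_⟩
      have hq0 : x / 2 ^ k ≠ 0 := div_ne_zero hx0 h2k0
      rw [odd_den_iff_padicValRat_nonneg, padicValRat.div hx0 h2k0, h2k]
      omega

/-- **`2^k ℤ_{(2)}` is stable under `2`-adic units:** for `u ≠ 0` with `ord₂ u = 0`, `u·x ∈ 2^k ℤ_{(2)} ⟺ x ∈ 2^k ℤ_{(2)}`. [folklore] -/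
theorem inTwoPowZLoc_unit_mul_iff {u : ℚ} (hu0 : u ≠ 0) (hu : padicValRat 2 u = 0) (k : ℕ) (x : ℚ) :
    InTwoPowZLoc k (u * x) ↔ InTwoPowZLoc k x := by
  rw [inTwoPowZLoc_iff_padicValRat, inTwoPowZLoc_iff_padicValRat]
  by_cases hx : x = 0
  · simp [hx]
  · have hux : u * x ≠ 0 := mul_ne_zero hu0 hx
    rw [padicValRat.mul hu0 hx, hu, zero_add]
    simp [hx, hux]

/-! ## The Legendre sum is `T_ℓ` -/

/-- The cell's `legendrePlusSymbolSum f ℓ = ∑_{a mod ℓ} (a/ℓ)[a/ℓ]⁺_f` is the fkl quadratic-twist sum `T_ℓ(f) = twistSymbolSum f ℓ`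
(both equal the sum over the units; `(0/ℓ) = 0`). [folklore] -/
theorem legendrePlusSymbolSum_eq_twistSymbolSum {M : ℕ} (f : CuspForm (Gamma0 M) 2) (ℓ : ℕ) [Fact ℓ.Prime] :
    legendrePlusSymbolSum f ℓ = twistSymbolSum f ℓ := by
  rw [legendrePlusSymbolSum_def, twistSymbolSum_eq_sum_units,
    sum_univ_zmod_eq_zero_add_sum_units (fun a : ZMod ℓ => (legendreSym ℓ (a.val : ℤ) : ℚ) * ratPlusSymbol f ((a.val : ℚ) / ℓ))]
  simp only [ZMod.val_zero, Nat.cast_zero, legendreSym.at_zero, Int.cast_zero, zero_mul, zero_add]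
  refine Finset.sum_congr rfl fun u _ => ?_
  rw [jacobiSym.legendreSym.to_jacobiSym]

/-! ## The Birch reading of `T_ℓ` -/

/-- **`L(E^{(ℓ)},1)/Ω(E^{(ℓ)}) = u⁻¹ · T_ℓ(f)` with `|u|₂ = 1`** (Birch × Pal × Gauss, the cell's PROVED
`Additive.entireLFunction_one_eq_of_twist_pos`, + the period transfer at `2`).  Setting: `W` globally minimal elliptic with newform `f` and
`PeriodTransferAtTwo W f`; `ℓ ≡ 1 (mod 4)` a prime of good reduction (`ℓ ∤ N_W`); `W'` a globally minimal model of `E^{(ℓ)}` with additive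
reduction at `ℓ`; `r ∈ ℚ` with `L(W',1) = r·Ω(W')`.  Conclusion: `r = v · T_ℓ(f)` for some `v ∈ ℚ` with `|v|₂ = 1`.  Named input: modularity
(`hasEntireLFunction_rat`). [cite: MazurTateTeitelbaum1986Invent, §I.8 (8.6)] [cite: Pal2012, Thm. 3.2] -/
theorem exists_unit_mul_twistSymbolSum_of_twistLValue (hmod : hasEntireLFunction_rat)
    (W : WeierstrassCurve ℚ) [W.IsElliptic] [W.IsGloballyMinimal] {M : ℕ} [NeZero M]
    (f : CuspForm (Gamma0 M) 2) (hf : IsNewformOf W f) (hper : PeriodTransferAtTwo W f)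
    (ℓ : ℕ) [Fact ℓ.Prime] (hN : ¬ ℓ ∣ W.conductorNorm ℤ) (h4 : 4 ∣ ℓ - 1)
    (W' : WeierstrassCurve ℚ) [W'.IsElliptic] [W'.IsGloballyMinimal] (C : VariableChange ℚ)
    (hC : C • W.quadraticTwist (ℓ : ℚ) = W') (hadd : Addv W' ℓ)
    (r : ℚ) (hL : W'.entireLFunction 1 = ((r : ℚ) : ℂ) * (W'.realPeriodRat : ℂ)) :
    ∃ v : ℚ, ‖(v : ℚ_[2])‖ = 1 ∧ r = v * twistSymbolSum f ℓ := by
  have hℓ : ℓ.Prime := Fact.out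
  have hp4 : ℓ % 4 = 1 := by
    have := hℓ.two_le
    omega
  have hgood : W.HasGoodReductionAtPrime ℓ := by
    by_contra hbad
    exact hN ((W.dvd_conductorNorm_iff_not_hasGoodReductionAtPrime ℓ).mpr hbad)
  obtain ⟨u, hu, hΩ⟩ := hper
  have hu0 : u ≠ 0 := by
    rintro rfl
    simp at hu
  have hϖ : ((u⁻¹ : ℚ) : ℝ) * W.realPeriodRat = plusPeriod f := by
    rw [hΩ]
    push_cast
    field_simp
  have key := entireLFunction_one_eq_of_twist_pos ℓ hmod hp4 W W' C hC (Or.inl hgood) hadd hf (u⁻¹) hϖ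
  rw [legendrePlusSymbolSum_eq_twistSymbolSum] at key
  have hΩ' : (W'.realPeriodRat : ℂ) ≠ 0 := by exact_mod_cast W'.realPeriodRat_pos_holds.ne'
  have hr : ((r : ℚ) : ℂ) = ((u⁻¹ * twistSymbolSum f ℓ : ℚ) : ℂ) := by
    have := hL.symm.trans key
    exact mul_right_cancel₀ hΩ' this
  refine ⟨u⁻¹, ?_, by exact_mod_cast hr⟩
  rw [Rat.cast_inv, norm_inv, hu, inv_one]

/-- **`L(E^{(ℓ)},1)/Ω(E^{(ℓ)}) ∈ 2^m ℤ_{(2)} ⟺ T_ℓ(f) ∈ 2^m ℤ_{(2)}`** in the setting of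
`exists_unit_mul_twistSymbolSum_of_twistLValue` (a `2`-adic unit does not move `2^m ℤ_{(2)}`). [folklore] -/
theorem inTwoPowZLoc_twistLValue_iff (hmod : hasEntireLFunction_rat)
    (W : WeierstrassCurve ℚ) [W.IsElliptic] [W.IsGloballyMinimal] {M : ℕ} [NeZero M]
    (f : CuspForm (Gamma0 M) 2) (hf : IsNewformOf W f) (hper : PeriodTransferAtTwo W f)
    (ℓ : ℕ) [Fact ℓ.Prime] (hN : ¬ ℓ ∣ W.conductorNorm ℤ) (h4 : 4 ∣ ℓ - 1)
    (W' : WeierstrassCurve ℚ) [W'.IsElliptic] [W'.IsGloballyMinimal] (C : VariableChange ℚ)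
    (hC : C • W.quadraticTwist (ℓ : ℚ) = W') (hadd : Addv W' ℓ)
    (r : ℚ) (hL : W'.entireLFunction 1 = ((r : ℚ) : ℂ) * (W'.realPeriodRat : ℂ)) (m : ℕ) :
    InTwoPowZLoc m r ↔ InTwoPowZLoc m (twistSymbolSum f ℓ) := by
  obtain ⟨v, hv, hr⟩ := exists_unit_mul_twistSymbolSum_of_twistLValue hmod W f hf hper ℓ hN h4 W' C hC hadd r hL
  have hv0 : v ≠ 0 := by
    rintro rfl
    simp at hv
  rw [hr]
  exact inTwoPowZLoc_unit_mul_iff hv0 (padicValRat_eq_zero_of_norm_ratCast_eq_one hv) m _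

/-- **(HC) at a level-2 row in L-value currency:** in the setting above with `W` of positive analytic rank, `ℓ` a `τ`-prime with
`4 ∣ ℓ − 1`, `ψ` onto `ℤ/4` and `s ≥ 1`:  `δ'_2(ℓ; ψ) ∈ 2^{min(2,s+1)} ℤ_{(2)} ⟺ L(E^{(ℓ)},1)/Ω(E^{(ℓ)}) ∈ 4ℤ_{(2)}`.
[conjecture] reading, kernel theorem. -/
theorem firstLayerHigherCongruence_levelTwo_iff_twistLValue (hmod : hasEntireLFunction_rat)
    (W : WeierstrassCurve ℚ) [W.IsElliptic] [W.IsGloballyMinimal] {M : ℕ} [NeZero M]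
    (f : CuspForm (Gamma0 M) 2) (hf : IsNewformOf W f) (hper : PeriodTransferAtTwo W f) (hr : W.analyticRank ≠ 0)
    {ℓ : ℕ} [Fact ℓ.Prime] (hlev : IsLevelAtTwo W ℓ) (h4 : (2 ^ 2 : ℤ) ∣ (ℓ : ℤ) - 1)
    (ψ : (ZMod ℓ)ˣ →* Multiplicative (ZMod (2 ^ 2))) (hψ : Function.Surjective ψ) {s : ℕ} (hs : 1 ≤ s)
    (W' : WeierstrassCurve ℚ) [W'.IsElliptic] [W'.IsGloballyMinimal] (C : VariableChange ℚ)
    (hC : C • W.quadraticTwist (ℓ : ℚ) = W') (hadd : Addv W' ℓ)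
    (r : ℚ) (hL : W'.entireLFunction 1 = ((r : ℚ) : ℂ) * (W'.realPeriodRat : ℂ)) :
    InTwoPowZLoc (min 2 (s + 1)) (levelSumTwo f ℓ 2 ψ) ↔ InTwoPowZLoc 2 r := by
  have hℓ : ℓ.Prime := Fact.out
  obtain ⟨-, hN⟩ := ne_two_and_not_dvd_of_isLevelAtTwo W hlev
  have h4' : 4 ∣ ℓ - 1 := by
    have h1 : 1 ≤ ℓ := hℓ.one_lt.le
    have : ((4 : ℕ) : ℤ) ∣ ((ℓ - 1 : ℕ) : ℤ) := by push_cast [Nat.cast_sub h1]; norm_num at h4; exact h4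
    exact Int.natCast_dvd_natCast.mp this
  rw [firstLayerHigherCongruence_levelTwo_iff W f hf hr hlev h4 ψ hψ hs,
    inTwoPowZLoc_twistLValue_iff hmod W f hf hper ℓ hN h4' W' C hC hadd r hL 2]

/-- **(NV) for parameter `0` from ONE twist L-value:** `W` globally minimal of positive analytic rank with newform `f` and the period
transfer at `2`; a `τ`-prime `ℓ` with `4 ∣ ℓ − 1`, `4 ∣ a_ℓ − 2`; a globally minimal model `W'` of `E^{(ℓ)}` (additive at `ℓ`) whose
L-value ratio `r = L(W',1)/Ω(W')` is NOT in `4ℤ_{(2)}` («`L^{alg}(E^{(ℓ)},1) = 2 × odd`»).  Then the first Kolyvagin layer of `(W, f)` has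
a row `(ℓ, 2, ψ)` with `δ'_2(ℓ;ψ) ∉ 2^{0+2} ℤ_{(2)}`.  Named input: modularity. [folklore] -/
theorem firstLayerNonVanishing_zero_of_twistLValue (hmod : hasEntireLFunction_rat)
    (W : WeierstrassCurve ℚ) [W.IsElliptic] [W.IsGloballyMinimal] {M : ℕ} [NeZero M]
    (f : CuspForm (Gamma0 M) 2) (hf : IsNewformOf W f) (hper : PeriodTransferAtTwo W f) (hr : W.analyticRank ≠ 0)
    (ℓ : ℕ) [Fact ℓ.Prime] (hlev : IsLevelAtTwo W ℓ) (h4 : 4 ∣ ℓ - 1) (ha : (2 ^ 2 : ℤ) ∣ W.frobeniusTrace ℓ - 2)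
    (W' : WeierstrassCurve ℚ) [W'.IsElliptic] [W'.IsGloballyMinimal] (C : VariableChange ℚ)
    (hC : C • W.quadraticTwist (ℓ : ℚ) = W') (hadd : Addv W' ℓ)
    (r : ℚ) (hL : W'.entireLFunction 1 = ((r : ℚ) : ℂ) * (W'.realPeriodRat : ℂ)) (hr2 : ¬ InTwoPowZLoc 2 r) :
    ∃ (ℓ k : ℕ) (_ : Fact ℓ.Prime) (ψ : (ZMod ℓ)ˣ →* Multiplicative (ZMod (2 ^ k))),
      IsLevelAtTwo W ℓ ∧ 0 + 2 ≤ k ∧ (2 ^ k : ℤ) ∣ (ℓ : ℤ) - 1 ∧ (2 ^ k : ℤ) ∣ W.frobeniusTrace ℓ - 2 ∧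
      Function.Surjective ψ ∧ ¬ InTwoPowZLoc (0 + 2) (levelSumTwo f ℓ k ψ) := by
  obtain ⟨-, hN⟩ := ne_two_and_not_dvd_of_isLevelAtTwo W hlev
  have hT : ¬ InTwoPowZLoc 2 (twistSymbolSum f ℓ) := by
    rwa [← inTwoPowZLoc_twistLValue_iff hmod W f hf hper ℓ hN h4 W' C hC hadd r hL 2]
  exact firstLayerNonVanishing_zero_of_twist' W f hf hr ℓ hlev h4 ha hT

/-- **Clause (b) of K2-F for `Ш(E)[2^∞] = 0` curves from ONE twist L-value** — under the binders of the v7 stub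
`stub_firstLayerNonVanishing` (the period transfer is now USED): `#Ш(E)[2^∞] = 1` and a `τ`-prime `ℓ` with `4 ∣ ℓ − 1`, `4 ∣ a_ℓ − 2`
and a minimal model of `E^{(ℓ)}` with `L(E^{(ℓ)},1)/Ω(E^{(ℓ)}) ∉ 4ℤ_{(2)}` give the stub's conclusion at `W`.  Named input: modularity.
[conjecture] instance, kernel theorem. -/
theorem stub_firstLayerNonVanishing_of_sha_trivial_of_twistLValue (hmod : hasEntireLFunction_rat)
    (W : WeierstrassCurve ℚ) [W.IsElliptic] [W.IsGloballyMinimal] {M : ℕ} [NeZero M]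
    (f : CuspForm (Gamma0 M) 2) (hf : IsNewformOf W f) (hper : PeriodTransferAtTwo W f)
    (_hsurj : ∀ n : ℕ, W.HasSurjectiveModNGaloisRep ((2 ^ n : ℕ) : ℤ)) (_hT : Odd W.torsionOrder)
    (_hc : Odd W.tamagawaProduct) (hw : W.rootNumber = -1) (_hr : W.mordellWeilRank = 1)
    (_hfin : Finite (AddCommGroup.primaryComponent W.sha 2))
    (hsha : Nat.card (AddCommGroup.primaryComponent W.sha 2) = 1)
    (htw : ∃ (ℓ : ℕ) (_ : Fact ℓ.Prime) (W' : WeierstrassCurve ℚ) (_ : W'.IsElliptic) (_ : W'.IsGloballyMinimal)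
      (C : VariableChange ℚ) (r : ℚ),
      IsLevelAtTwo W ℓ ∧ 4 ∣ ℓ - 1 ∧ (2 ^ 2 : ℤ) ∣ W.frobeniusTrace ℓ - 2 ∧ C • W.quadraticTwist (ℓ : ℚ) = W' ∧ Addv W' ℓ ∧
      W'.entireLFunction 1 = ((r : ℚ) : ℂ) * (W'.realPeriodRat : ℂ) ∧ ¬ InTwoPowZLoc 2 r) :
    let s := padicValNat 2 (Nat.card (AddCommGroup.primaryComponent W.sha 2))
    ∃ (ℓ k : ℕ) (_ : Fact ℓ.Prime) (ψ : (ZMod ℓ)ˣ →* Multiplicative (ZMod (2 ^ k))),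
      IsLevelAtTwo W ℓ ∧ s + 2 ≤ k ∧ (2 ^ k : ℤ) ∣ (ℓ : ℤ) - 1 ∧ (2 ^ k : ℤ) ∣ W.frobeniusTrace ℓ - 2 ∧
      Function.Surjective ψ ∧ ¬ InTwoPowZLoc (s + 2) (levelSumTwo f ℓ k ψ) := by
  simp only [hsha, padicValNat_one_right]
  obtain ⟨ℓ, hℓ, W', hW'e, hW'm, C, r, hlev, h4, ha, hC, hadd, hL, hr2⟩ := htw
  exact firstLayerNonVanishing_zero_of_twistLValue hmod W f hf hper (W.analyticRank_pos_of_rootNumber_eq_neg_one hw).ne'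
    ℓ hlev h4 ha W' C hC hadd r hL hr2

end Summit.BirchSwinnertonDyer.BirchSwinnertonDyer.Theorems.RankOneAtTwoFkl

end
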